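import Summits.QuantumFields.YangMills.Theorems.LangevinControlUVOSLegsAtWeakCouplingCStubInheritGeometry
import Summits.QuantumFields.YangMills.Theorems.LangevinControlUVOSLegsAtWeakCouplingCStubTameFitWindow
import HarnessLib

/-!
# Stub `stub_inherit` of line `inherited-amplitude-gates` (crux `OSLegsAtWeakCouplingC`, stmt-QuantumFields-16207):
# the inheritance lemma `Continuous a → H1 → FitWindow → FBL6 → GateAxis → GateD → FlatShape2 → FC2I`

Assembly of the registered stub from auxiliary files 1–4 (`…StubInheritTorus`, `…StubInheritAxis`, `…StubInheritPair`,
`…StubInheritGeometry`) and the sibling stub's `growthWindow_of_fitWindow'` (`…StubTameFitWindow`):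

* (U): with the FIXED gate parameter `κ_U = ⌈2√C_g⌉ + ⌈2√C_g'⌉ + 8`, `pair_upper` bounds `|ν⁸ kerCov_η(dens x, dens y)|`
  on every femto cube for every exterior;
* (L): given `(K_c, t)`, take `K_f` large (formula below), a growth window `[u, v]` of `Γ` for `K_f` below
  `t / (16 (κ_U + κ₇ + 8))` (`growthWindow_of_fitWindow'`: FitWindow + H1's upper bound + IVT), thin it to
  `s₁ = max u (v/2)`, `s₂ = (s₁ + v)/2` (`s₂ ≤ 3 s₁ / 2`, room `v − s₂ > 0` for the extra lattice unit of `m a`), choose the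
  gate parameter `κ_L = ⌈(E/(K_f s₁⁸))^{1/8}⌉ + κ_U + 3` (so `K_f s₁⁸ (κ_L − 2)⁸ ≥ E` beats both budget constants, while
  the physical collar `κ_L s₂ ≲ (E/K_f)^{1/8} + (κ_U + 4) s₂` stays below `t`), and `pair_lower` gives the floor
  `θ c K_f s₁⁸ / 8 ≥ K_c s₂⁸`.

Refs: line card `Cruxes/OSLegsAtWeakCouplingC/Lines/inherited-amplitude-gates.md` (stub_inherit (i)–(v)).
-/

set_option autoImplicit false

noncomputable section

open scoped BigOperators
open MeasureTheory Filter Topology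
open Literature.MathematicalPhysics.QuantumFieldTheory Literature.MathematicalPhysics.QuantumLattice
open Literature.MathematicalPhysics.AQFT Literature.Probability.LatticeModels
open Summit.QuantumFields.YangMills.Cruxes.OSLegsFromFemtoAndGap.DlrCollarTransfer
open Summit.QuantumFields.YangMills.Cruxes.OSLegsFromFemtoAndGap.DlrCollarTransfer.StubLower
open Summit.QuantumFields.YangMills.Theorems.OSLegsFromFemtoAndGap.StubLower

namespace Summit.QuantumFields.YangMills.Cruxes.OSLegsAtWeakCouplingC.InheritedAmplitudeGates.StubInherit

/-! ### The inheritance lemma -/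

section Assembly

variable (G : Type) [Group G] [TopologicalSpace G] [IsTopologicalGroup G] [CompactSpace G]
  [MeasurableSpace G] [BorelSpace G] (r : LatticeRep G) (a : ℝ → ℝ)

/-- **`FC2I` from the data (binder form of `stub_inherit`).**  For a continuous unit map `a` with H1's witnesses
(`Γ, β₀, ℓ₀, c, C`; `a > 0`, `a → 0`, `0 < Γ ≤ 1` on `(0, ℓ₀]`, the verbatim femto-box clause), `FitWindow`, and the
witnesses/clauses of `FBL6`, `GateAxis`, `GateD`, `FlatShape2`: the inherited conditional two-point package `FC2I G r a`
((U) with the fixed gate parameter `κ_U`, (L) uniformly in the room `(K_c, t)` — see the module docstring). [folklore] -/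
theorem fc2I_of_data (ha : Continuous a)

    {Γ : ℝ → ℝ} {β₀ ℓ₀ c C : ℝ} (hℓ₀ : 0 < ℓ₀) (hc : 0 < c) (hpos : ∀ β, 0 < a β)
    (hlim : Filter.Tendsto a Filter.atTop (nhds 0)) (hΓ : ∀ s : ℝ, 0 < s → s ≤ ℓ₀ → 0 < Γ s ∧ Γ s ≤ 1)
    (hbox : ∀ (L : ℕ) [NeZero L] (β : ℝ), β₀ ≤ β → (L : ℝ) * a β ≤ ℓ₀ → let P : (Fin 4 → ZMod L) → Fin 4 → Fin 4 → GaugeConfig 4 L G → ℝ := fun x i j U => (r.N : ℝ) - (r.ρ (plaquetteHolonomy U x i j)).trace.re; let E : (GaugeConfig 4 L G → ℝ) → ℝ := fun F => wilsonExpectation (d := 4) (L := L) r.ρ β F; let cov : (GaugeConfig 4 L G → ℝ) → (GaugeConfig 4 L G → ℝ) → ℝ := fun F F' => E (fun U => F U * F' U) - E F * E F'; let dist : (Fin 4 → ZMod L) → (Fin 4 → ZMod L) → ℝ := fun x y => Real.sqrt (∑ k : Fin 4, (((x k - y k).valMinAbs : ℤ) : ℝ) ^ 2); (∀ n : ℕ,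 1 ≤ n → 8 * n ≤ L → c * Γ ((n : ℝ) * a β) ≤ (n : ℝ) ^ 8 * cov (P 0 0 1) (P (Pi.single (2 : Fin 4) ((n : ℕ) : ZMod L)) 0 1) ∧ (n : ℝ) ^ 8 * cov (P 0 0 1) (P (Pi.single (2 : Fin 4) ((n : ℕ) : ZMod L)) 0 1) ≤ C * Γ ((n : ℝ) * a β)) ∧ (∀ (x y : Fin 4 → ZMod L) (i j i' j' : Fin 4), x ≠ y → i ≠ j → i' ≠ j' → |cov (P x i j) (P y i' j')| * dist x y ^ 8 ≤ C * Γ (dist x y * a β)))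
    (hfit : FitWindow G r a)
    {C₁ β₁ ℓ₁ : ℝ} {p : Fin 4 × Fin 4 → ℝ → ℝ} (hℓ₁ : 0 < ℓ₁) (hC₁ : 0 ≤ C₁)
    (hFBL : ∀ β : ℝ, β₁ ≤ β → ∀ (c : Fin 4 → ℤ) (b : ℕ), (b : ℝ) * a β ≤ ℓ₁ →
      ∀ (η : LGConfig 4 G) (q : Fin 4 × Fin 4) (x : Fin 4 → ℤ), q.1 < q.2 → 2 ≤ depth c b x →
        |kerE G r β c b η (plane G r q x) - p q β| ≤ C₁ / (depth c b x : ℝ) ^ 4)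
    {Cg β₆ ℓ₆ : ℝ} {n₆ : ℕ} (hCg : 0 < Cg) (hℓ₆ : 0 < ℓ₆) (_hn₆ : 1 ≤ n₆)
    (hGA : ∀ β : ℝ, β₆ ≤ β → ∀ κ : ℕ, 8 ≤ κ →
      ∀ (c : Fin 4 → ℤ) (b : ℕ), (b : ℝ) * a β ≤ ℓ₆ → ∀ (η : LGConfig 4 G) (x : Fin 4 → ℤ) (n : ℕ), n₆ ≤ n →
        κ * n ≤ depth c b x → κ * n ≤ depth c b (x + Pi.single (2 : Fin 4) (n : ℤ)) →
        ∀ M : ℝ, 0 ≤ M →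
          (∀ (q : Fin 4 × Fin 4) (z : Fin 4 → ℤ), q.1 < q.2 → (κ - 2) * n ≤ depth c b z →
            |kerE G r β c b η (plane G r q z) - kerE G r β c b 1 (plane G r q z)| ≤ M) →
          |kerCov G r β c b η (plane G r (0, 1) x) (plane G r (0, 1) (x + Pi.single (2 : Fin 4) (n : ℤ))) -
              kerCov G r β c b 1 (plane G r (0, 1) x) (plane G r (0, 1) (x + Pi.single (2 : Fin 4) (n : ℤ)))| ≤
            Cg * (M * Real.sqrt (kerCov G r β c b 1 (plane G r (0, 1) x) (plane G r (0, 1) (x + Pi.single (2 : Fin 4) (n : ℤ)))) +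
              M ^ 2 + |kerCov G r β c b 1 (plane G r (0, 1) x) (plane G r (0, 1) (x + Pi.single (2 : Fin 4) (n : ℤ)))| / (κ : ℝ) ^ 2))
    {Cg' β₆' ℓ₆' : ℝ} {n₆' : ℕ} (hCg' : 0 < Cg') (hℓ₆' : 0 < ℓ₆')
    (hGD : ∀ β : ℝ, β₆' ≤ β → ∀ κ : ℕ, 8 ≤ κ →
      ∀ (c : Fin 4 → ℤ) (b : ℕ), (b : ℝ) * a β ≤ ℓ₆' → ∀ (η : LGConfig 4 G) (x y : Fin 4 → ℤ),
        (n₆' : ℝ) ≤ ‖siteToE (y - x)‖ →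
        (κ : ℝ) * ‖siteToE (y - x)‖ ≤ depth c b x → (κ : ℝ) * ‖siteToE (y - x)‖ ≤ depth c b y →
        ∀ M : ℝ, 0 ≤ M →
          (∀ (q : Fin 4 × Fin 4) (z : Fin 4 → ℤ), q.1 < q.2 → ((κ : ℝ) - 2) * ‖siteToE (y - x)‖ ≤ depth c b z →
            |kerE G r β c b η (plane G r q z) - kerE G r β c b 1 (plane G r q z)| ≤ M) →
          |kerCov G r β c b η (dens G r x) (dens G r y) - kerCov G r β c b 1 (dens G r x) (dens G r y)| ≤
            Cg' * (M * Real.sqrt (kerCov G r β c b 1 (dens G r x) (dens G r y)) + M ^ 2 +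
              |kerCov G r β c b 1 (dens G r x) (dens G r y)| / (κ : ℝ) ^ 2))
    {θ β₇ ℓ₇ : ℝ} {κ₇ n₇ : ℕ} (hθ : 0 < θ) (hℓ₇ : 0 < ℓ₇)
    (hFS : ∀ β : ℝ, β₇ ≤ β →
      ∀ (c : Fin 4 → ℤ) (b : ℕ), (b : ℝ) * a β ≤ ℓ₇ → ∀ (x y x' : Fin 4 → ℤ) (m : ℕ),
        (n₇ : ℝ) ≤ ‖siteToE (y - x)‖ → ‖siteToE (y - x)‖ ≤ m → (m : ℝ) ≤ 2 * ‖siteToE (y - x)‖ →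
        (κ₇ : ℝ) * m ≤ depth c b x → (κ₇ : ℝ) * m ≤ depth c b y →
        (κ₇ : ℝ) * m ≤ depth c b x' → (κ₇ : ℝ) * m ≤ depth c b (x' + Pi.single (2 : Fin 4) (m : ℤ)) →
          θ * kerCov G r β c b 1 (plane G r (0, 1) x') (plane G r (0, 1) (x' + Pi.single (2 : Fin 4) (m : ℤ))) ≤
            kerCov G r β c b 1 (dens G r x) (dens G r y) ∧
          θ * kerCov G r β c b 1 (dens G r x) (dens G r y) ≤
            kerCov G r β c b 1 (plane G r (0, 1) x') (plane G r (0, 1) (x' + Pi.single (2 : Fin 4) (m : ℤ))))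
    : FC2I G r a := by
  -- the fixed gate parameter and the common constants
  obtain ⟨κU, hκU⟩ : ∃ κU : ℕ, κU = ⌈2 * Real.sqrt Cg⌉₊ + ⌈2 * Real.sqrt Cg'⌉₊ + 8 := ⟨_, rfl⟩
  obtain ⟨hκU8, hκUCg, hκUCg'⟩ : 8 ≤ κU ∧ 4 * Cg ≤ (κU : ℝ) ^ 2 ∧ 4 * Cg' ≤ (κU : ℝ) ^ 2 := by
    rw [hκU]; exact kappaU_spec hCg.le hCg'.le
  obtain ⟨n₀, hn₀⟩ : ∃ n₀ : ℕ, n₀ = max 2 (max n₆ (max n₆' n₇)) := ⟨_, rfl⟩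
  have hn₀2 : 2 ≤ n₀ := by rw [hn₀]; exact le_max_left _ _
  have hn₀₆ : n₆ ≤ n₀ := by rw [hn₀]; exact (le_max_left _ _).trans (le_max_right _ _)
  have hn₀₆' : n₆' ≤ n₀ := by rw [hn₀]; exact ((le_max_left _ _).trans (le_max_right _ _)).trans (le_max_right _ _)
  have hn₀₇ : n₇ ≤ n₀ := by rw [hn₀]; exact ((le_max_right _ _).trans (le_max_right _ _)).trans (le_max_right _ _)
  obtain ⟨ℓ₂, hℓ₂⟩ : ∃ ℓ₂ : ℝ, ℓ₂ = min (min ℓ₁ ℓ₆) (min (min ℓ₆' ℓ₇) (ℓ₀ / 2)) := ⟨_, rfl⟩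
  have hℓ₂0 : 0 < ℓ₂ := by rw [hℓ₂]; exact lt_min (lt_min hℓ₁ hℓ₆) (lt_min (lt_min hℓ₆' hℓ₇) (by positivity))
  have hℓ₂₁ : ℓ₂ ≤ ℓ₁ := by rw [hℓ₂]; exact (min_le_left _ _).trans (min_le_left _ _)
  have hℓ₂₆ : ℓ₂ ≤ ℓ₆ := by rw [hℓ₂]; exact (min_le_left _ _).trans (min_le_right _ _)
  have hℓ₂₆' : ℓ₂ ≤ ℓ₆' := by rw [hℓ₂]; exact (min_le_right _ _).trans ((min_le_left _ _).trans (min_le_left _ _))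
  have hℓ₂₇ : ℓ₂ ≤ ℓ₇ := by rw [hℓ₂]; exact (min_le_right _ _).trans ((min_le_left _ _).trans (min_le_right _ _))
  have hℓ₂₀ : ℓ₂ ≤ ℓ₀ / 2 := by rw [hℓ₂]; exact (min_le_right _ _).trans (min_le_right _ _)
  obtain ⟨βa, hβa⟩ := exists_of_tendsto_atTop_nhds_zero hlim (a₀ := ℓ₀ / 6) (by positivity)
  obtain ⟨β₂, hβ₂⟩ : ∃ β₂ : ℝ, β₂ = max (max (max β₀ β₁) (max β₆ β₆')) (max β₇ βa) := ⟨_, rfl⟩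
  have hthr : ∀ β : ℝ, β₂ ≤ β → β₀ ≤ β ∧ β₁ ≤ β ∧ β₆ ≤ β ∧ β₆' ≤ β ∧ β₇ ≤ β ∧ a β < ℓ₀ / 6 := by
    intro β hβ
    rw [hβ₂] at hβ
    have h1 := le_of_max_le_left hβ
    have h2 := le_of_max_le_right hβ
    exact ⟨le_of_max_le_left (le_of_max_le_left h1), le_of_max_le_right (le_of_max_le_left h1),
      le_of_max_le_left (le_of_max_le_right h1), le_of_max_le_right (le_of_max_le_right h1),
      le_of_max_le_left h2, hβa β (le_of_max_le_right h2)⟩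
  have hfem : ∀ (β : ℝ) (b : ℕ), a β < ℓ₀ / 6 → (b : ℝ) * a β ≤ ℓ₂ →
      (b : ℝ) * a β ≤ ℓ₁ ∧ (b : ℝ) * a β ≤ ℓ₆ ∧ (b : ℝ) * a β ≤ ℓ₆' ∧ (b : ℝ) * a β ≤ ℓ₇ ∧
      ((b : ℝ) + 3) * a β ≤ ℓ₀ := by
    intro β b haℓ hb
    exact ⟨hb.trans hℓ₂₁, hb.trans hℓ₂₆, hb.trans hℓ₂₆', hb.trans hℓ₂₇, by
      have e : ((b : ℝ) + 3) * a β = (b : ℝ) * a β + 3 * a β := by ring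
      linarith only [hb.trans hℓ₂₀, haℓ, e]⟩
  -- separation facts from `n₀ ≤ ν`
  have hsep : ∀ {x y : Fin 4 → ℤ}, (n₀ : ℝ) ≤ ‖siteToE (y - x)‖ →
      1 ≤ ‖siteToE (y - x)‖ ∧ (n₆' : ℝ) ≤ ‖siteToE (y - x)‖ ∧ (n₇ : ℝ) ≤ ‖siteToE (y - x)‖ ∧
      n₆ ≤ ⌈‖siteToE (y - x)‖⌉₊ := by
    intro x y hn
    have h2 : (2 : ℝ) ≤ n₀ := by exact_mod_cast hn₀2
    have h6' : (n₆' : ℝ) ≤ n₀ := by exact_mod_cast hn₀₆'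
    have h7 : (n₇ : ℝ) ≤ n₀ := by exact_mod_cast hn₀₇
    have h6 : (n₆ : ℝ) ≤ n₀ := by exact_mod_cast hn₀₆
    refine ⟨by linarith only [h2, hn], by linarith only [h6', hn], by linarith only [h7, hn], ?_⟩
    have : (n₆ : ℝ) ≤ ⌈‖siteToE (y - x)‖⌉₊ := (h6.trans hn).trans (Nat.le_ceil _)
    exact_mod_cast this
  obtain ⟨κ₂, hκ₂⟩ : ∃ κ₂ : ℕ, κ₂ = 2 * κU + 2 * κ₇ + 4 := ⟨_, rfl⟩
  refine ⟨β₂, ℓ₂, ?_, κ₂, n₀, hℓ₂0, le_trans (by norm_num) hn₀2, ?_, ?_⟩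
  rotate_left
  · -- (U) the unconditional hyperscaling bound
    intro β hβ cc b hb η x y hn hdx hdy
    rw [hκ₂] at hdx hdy
    obtain ⟨hβ₀, hβ₁, hβ₆, hβ₆', hβ₇, haℓ⟩ := hthr β hβ
    obtain ⟨hb₁, hb₆, hb₆', hb₇, hb₀⟩ := hfem β b haℓ hb
    obtain ⟨hν1, hn₆'ν, hn₇ν, hn₆m⟩ := hsep hn
    obtain ⟨m, hm⟩ : ∃ m : ℕ, m = ⌈‖siteToE (y - x)‖⌉₊ := ⟨_, rfl⟩
    obtain ⟨hm1, hνm, hm2, -, h8m, hdxm, hdx'm, hdxr, hdyr, h7x, h7y, h7x'⟩ :=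
      pair_geometry (κ₇ := κ₇) hκU8 m hm hν1 hdx hdy
    have hn₆m : n₆ ≤ m := by rw [hm]; exact hn₆m
    exact pair_upper G r a hc hΓ hbox hC₁ hFBL hGA hCg' hGD hθ hFS hβ₀ hβ₁ hβ₆ hβ₆' hβ₇ (hpos β) hb₁ hb₆ hb₆' hb₇ hb₀
      hκU8 hκUCg hκUCg' η hν1 hn₆'ν hn₇ν hm1 hn₆m hνm hm2 h8m hdxm hdx'm hdxr hdyr h7x h7y h7x'
  · -- (L) the windowed floor, uniform in the room `(K_c, t)`
    intro Kc t ht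
    -- the fit constant `K_f`
    obtain ⟨E', hE'⟩ : ∃ E' : ℝ, E' = (16 * (1 + Cg + Cg ^ 2) + 32 * (Cg' + Cg' ^ 2) / θ) * C₁ ^ 2 / c := ⟨_, rfl⟩
    have hE'0 : 0 ≤ E' := by rw [hE']; positivity
    obtain ⟨Kf, hKf⟩ : ∃ Kf : ℝ, Kf = 2048 * max Kc 0 / (θ * c) + E' * (32 / t) ^ 8 + 1 := ⟨_, rfl⟩
    have hKc0 : 0 ≤ max Kc 0 := le_max_right _ _
    have hA0 : 0 ≤ 2048 * max Kc 0 / (θ * c) := by positivity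
    have hB0 : 0 ≤ E' * (32 / t) ^ 8 := by positivity
    have hKf0 : 0 < Kf := by rw [hKf]; linarith only [hA0, hB0]
    have hKfKc : 2048 * max Kc 0 ≤ θ * c * Kf := by
      have hθc : 0 < θ * c := mul_pos hθ hc
      have e1 : θ * c * (2048 * max Kc 0 / (θ * c)) = 2048 * max Kc 0 := by field_simp
      have e : θ * c * Kf = 2048 * max Kc 0 + θ * c * (E' * (32 / t) ^ 8 + 1) := by
        rw [hKf, mul_add, mul_add, e1]; ring
      have : 0 ≤ θ * c * (E' * (32 / t) ^ 8 + 1) := by positivity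
      linarith only [e, this]
    have hKfE : E' * (32 / t) ^ 8 ≤ Kf := by rw [hKf]; linarith only [hA0]
    -- the growth window of `Γ` for `K_f`, below `t' = t / (16 (κ_U + κ₇ + 8))`
    obtain ⟨t', ht'⟩ : ∃ t' : ℝ, t' = t / (16 * ((κU : ℝ) + κ₇ + 8)) := ⟨_, rfl⟩
    have ht'0 : 0 < t' := by rw [ht']; positivity
    have ht't : t' ≤ t := by
      rw [ht', div_le_iff₀ (by positivity)]
      have h1 : (0 : ℝ) ≤ κU := Nat.cast_nonneg _
      have h2 : (0 : ℝ) ≤ κ₇ := Nat.cast_nonneg _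
      nlinarith only [h1, h2, ht]
    obtain ⟨u, v, hu, huv, hvt, hwin⟩ := StubTame.growthWindow_of_fitWindow' G r a ha hℓ₀ hc hpos
      (fun s hs hsl => (hΓ s hs hsl).1) hbox hfit Kf t' ht'0
    -- the thin window `[s₁, s₂]`, `s₂ ≤ 3 s₁ / 2`, with room `v − s₂ > 0`
    obtain ⟨s₁, hs₁⟩ : ∃ s₁ : ℝ, s₁ = max u (v / 2) := ⟨_, rfl⟩
    obtain ⟨s₂, hs₂⟩ : ∃ s₂ : ℝ, s₂ = (s₁ + v) / 2 := ⟨_, rfl⟩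
    have hus₁ : u ≤ s₁ := by rw [hs₁]; exact le_max_left _ _
    have hvs₁ : v / 2 ≤ s₁ := by rw [hs₁]; exact le_max_right _ _
    have hs₁v : s₁ < v := by rw [hs₁]; exact max_lt huv (by linarith only [hu, huv])
    have hs₁0 : 0 < s₁ := hu.trans_le hus₁
    have hs₁₂ : s₁ < s₂ := by rw [hs₂]; linarith only [hs₁v]
    have hs₂v : s₂ < v := by rw [hs₂]; linarith only [hs₁v]
    have hs₂s₁ : s₂ ≤ 3 / 2 * s₁ := by rw [hs₂]; linarith only [hvs₁]
    have hs₂t' : s₂ ≤ t' := hs₂v.le.trans hvt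
    -- the gate parameter `κ_L`
    obtain ⟨ρ, hρ⟩ : ∃ ρ : ℝ, ρ = Real.sqrt (Real.sqrt (Real.sqrt (E' / (Kf * s₁ ^ 8)))) := ⟨_, rfl⟩
    obtain ⟨hρ0, hρ8⟩ : 0 ≤ ρ ∧ ρ ^ 8 = E' / (Kf * s₁ ^ 8) := by rw [hρ]; exact sqrt3_pow_eight (by positivity)
    obtain ⟨κL, hκL⟩ : ∃ κL : ℕ, κL = ⌈ρ⌉₊ + κU + 3 := ⟨_, rfl⟩
    have hκLU : κU ≤ κL := by rw [hκL]; omega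
    have hκL8 : 8 ≤ κL := le_trans hκU8 hκLU
    have hκL1 : ρ + 1 ≤ (κL : ℝ) - 2 := by
      rw [hκL]; push_cast
      have : (0 : ℝ) ≤ κU := Nat.cast_nonneg _
      linarith only [Nat.le_ceil ρ, this]
    have hκL2 : (κL : ℝ) ≤ ρ + κU + 4 := by
      rw [hκL]; push_cast
      linarith only [(Nat.ceil_lt_add_one hρ0).le]
    -- `E' ≤ K_f s₁⁸ (κ_L − 2)⁸`, hence both budget constants are beaten
    have hEκ : E' ≤ Kf * s₁ ^ 8 * ((κL : ℝ) - 2) ^ 8 := by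
      have h1 : ρ ≤ (κL : ℝ) - 2 := by
        have : (0 : ℝ) ≤ κU := Nat.cast_nonneg _
        linarith only [hκL1, this]
      have h2 : ρ ^ 8 ≤ ((κL : ℝ) - 2) ^ 8 := pow_le_pow_left₀ hρ0 h1 8
      rw [hρ8, div_le_iff₀ (by positivity)] at h2
      linarith only [h2]
    have hcE' : c * E' = (16 * (1 + Cg + Cg ^ 2) + 32 * (Cg' + Cg' ^ 2) / θ) * C₁ ^ 2 := by
      rw [hE']; field_simp
    have hκE : 16 * (1 + Cg + Cg ^ 2) * C₁ ^ 2 ≤ c * Kf * s₁ ^ 8 * ((κL : ℝ) - 2) ^ 8 := by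
      have h1 : c * E' ≤ c * (Kf * s₁ ^ 8 * ((κL : ℝ) - 2) ^ 8) := mul_le_mul_of_nonneg_left hEκ hc.le
      have h2 : 0 ≤ 32 * (Cg' + Cg' ^ 2) / θ * C₁ ^ 2 := by positivity
      have e : (16 * (1 + Cg + Cg ^ 2) + 32 * (Cg' + Cg' ^ 2) / θ) * C₁ ^ 2 =
          16 * (1 + Cg + Cg ^ 2) * C₁ ^ 2 + 32 * (Cg' + Cg' ^ 2) / θ * C₁ ^ 2 := by ring
      have e2 : c * (Kf * s₁ ^ 8 * ((κL : ℝ) - 2) ^ 8) = c * Kf * s₁ ^ 8 * ((κL : ℝ) - 2) ^ 8 := by ring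
      linarith only [h1, h2, e, e2, hcE']
    have hκE' : 32 * (Cg' + Cg' ^ 2) * C₁ ^ 2 ≤ θ * c * Kf * s₁ ^ 8 * ((κL : ℝ) - 2) ^ 8 := by
      have h1 : θ * (c * E') ≤ θ * (c * (Kf * s₁ ^ 8 * ((κL : ℝ) - 2) ^ 8)) :=
        mul_le_mul_of_nonneg_left (mul_le_mul_of_nonneg_left hEκ hc.le) hθ.le
      have e : θ * ((16 * (1 + Cg + Cg ^ 2) + 32 * (Cg' + Cg' ^ 2) / θ) * C₁ ^ 2) =
          θ * (16 * (1 + Cg + Cg ^ 2)) * C₁ ^ 2 + 32 * (Cg' + Cg' ^ 2) * C₁ ^ 2 := by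
        field_simp
      have h0 : 0 ≤ θ * (16 * (1 + Cg + Cg ^ 2)) * C₁ ^ 2 := by positivity
      have e2 : θ * (c * (Kf * s₁ ^ 8 * ((κL : ℝ) - 2) ^ 8)) = θ * c * Kf * s₁ ^ 8 * ((κL : ℝ) - 2) ^ 8 := by ring
      have e3 : θ * (c * E') = θ * ((16 * (1 + Cg + Cg ^ 2) + 32 * (Cg' + Cg' ^ 2) / θ) * C₁ ^ 2) := by rw [hcE']
      linarith only [h1, e, h0, e2, e3]
    -- the collar fits: `κ₃ s₂ ≤ t`
    have hρs₁ : ρ * s₁ ≤ t / 32 := by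
      have h8 : (ρ * s₁) ^ 8 ≤ (t / 32) ^ 8 := by
        rw [mul_pow, hρ8]
        have e : E' / (Kf * s₁ ^ 8) * s₁ ^ 8 = E' / Kf := by field_simp
        rw [e, div_le_iff₀ hKf0]
        have e2 : E' * (32 / t) ^ 8 * (t / 32) ^ 8 = E' := by field_simp
        have h3 := mul_le_mul_of_nonneg_right hKfE (by positivity : (0 : ℝ) ≤ (t / 32) ^ 8)
        rw [e2, mul_comm] at h3
        exact h3
      exact le_of_pow_le_pow_left₀ (by norm_num) (by positivity) h8
    obtain ⟨κ₃, hκ₃⟩ : ∃ κ₃ : ℕ, κ₃ = 2 * κL + 2 * κ₇ + 4 := ⟨_, rfl⟩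
    have hcollar : (κ₃ : ℝ) * s₂ ≤ t := by
      rw [hκ₃]
      push_cast
      have hκU0 : (0 : ℝ) ≤ κU := Nat.cast_nonneg _
      have hκ₇0 : (0 : ℝ) ≤ κ₇ := Nat.cast_nonneg _
      have hs₂0 : 0 ≤ s₂ := by linarith only [hs₁0, hs₁₂]
      have hc1 : 2 * (κL : ℝ) + 2 * κ₇ + 4 ≤ 2 * ρ + (2 * κU + 2 * κ₇ + 12) := by linarith only [hκL2]
      have h1 := mul_le_mul_of_nonneg_right hc1 hs₂0
      have e1 : (2 * ρ + (2 * (κU : ℝ) + 2 * κ₇ + 12)) * s₂ = 2 * ρ * s₂ + (2 * κU + 2 * κ₇ + 12) * s₂ := by ring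
      have h2 : 2 * ρ * s₂ ≤ 2 * ρ * (3 / 2 * s₁) := mul_le_mul_of_nonneg_left hs₂s₁ (by positivity)
      have e2 : 2 * ρ * (3 / 2 * s₁) = 3 * (ρ * s₁) := by ring
      have h3 : (2 * (κU : ℝ) + 2 * κ₇ + 12) * s₂ ≤ (2 * κU + 2 * κ₇ + 12) * t' :=
        mul_le_mul_of_nonneg_left hs₂t' (by positivity)
      have h4 : (2 * (κU : ℝ) + 2 * κ₇ + 12) * t' ≤ t / 8 := by
        rw [ht', mul_div_assoc', div_le_iff₀ (by positivity)]
        have e : t / 8 * (16 * ((κU : ℝ) + κ₇ + 8)) - (2 * κU + 2 * κ₇ + 12) * t = 4 * t := by ring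
        linarith only [e, ht]
      linarith only [h1, e1, h2, e2, h3, h4, hρs₁, ht]
    -- the floor beats `K_c s₂⁸`
    have hfloor : Kc * s₂ ^ 8 ≤ θ * c * Kf * s₁ ^ 8 / 8 := by
      have h1 : Kc * s₂ ^ 8 ≤ max Kc 0 * s₂ ^ 8 := mul_le_mul_of_nonneg_right (le_max_left _ _) (by positivity)
      have h2 : s₂ ^ 8 ≤ (2 * s₁) ^ 8 := pow_le_pow_left₀ (by linarith only [hs₁0, hs₁₂]) (by linarith only [hs₂s₁, hs₁0]) 8
      have h3 : max Kc 0 * s₂ ^ 8 ≤ max Kc 0 * (2 * s₁) ^ 8 := mul_le_mul_of_nonneg_left h2 hKc0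
      have e : (2 * s₁) ^ 8 = 256 * s₁ ^ 8 := by ring
      have h4 : 0 ≤ s₁ ^ 8 := by positivity
      rw [e] at h3
      have h5 := mul_le_mul_of_nonneg_right hKfKc h4
      linarith only [h1, h3, h5]
    -- room for the extra lattice unit of `m a`: `a < v − s₂` beyond `βb`
    obtain ⟨βb, hβb⟩ := exists_of_tendsto_atTop_nhds_zero hlim (a₀ := v - s₂) (by linarith only [hs₂v])
    refine ⟨s₁, s₂, _, max β₂ βb, κ₃, hs₁0, hs₁₂, hs₂t'.trans ht't, hcollar, hfloor, ?_⟩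
    intro β hβ cc b hb η x y hn hdx hdy hσ₁ hσ₂
    have hβ2 : β₂ ≤ β := le_of_max_le_left hβ
    obtain ⟨hβ₀, hβ₁, hβ₆, hβ₆', hβ₇, haℓ⟩ := hthr β hβ2
    obtain ⟨hb₁, hb₆, hb₆', hb₇, hb₀⟩ := hfem β b haℓ hb
    obtain ⟨hν1, hn₆'ν, hn₇ν, hn₆m⟩ := hsep hn
    have hα := hpos β
    have haroom : a β < v - s₂ := hβb β (le_of_max_le_right hβ)
    rw [hκ₃] at hdx hdy
    obtain ⟨m, hm⟩ : ∃ m : ℕ, m = ⌈‖siteToE (y - x)‖⌉₊ := ⟨_, rfl⟩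
    obtain ⟨hm1, hνm, hm2, hm1', h8m, hdxm, hdx'm, hdxr, hdyr, h7x, h7y, h7x'⟩ :=
      pair_geometry (κ₇ := κ₇) hκL8 m hm hν1 hdx hdy
    have hn₆m : n₆ ≤ m := by rw [hm]; exact hn₆m
    -- the axis scale `m a` lies in the growth window
    have hΓm : Kf * ((m : ℝ) * a β) ^ 8 ≤ Γ ((m : ℝ) * a β) := by
      refine hwin _ ?_ ?_
      · exact hus₁.trans (hσ₁.trans (mul_le_mul_of_nonneg_right hνm hα.le))
      · have h1 : (m : ℝ) * a β ≤ (‖siteToE (y - x)‖ + 1) * a β := mul_le_mul_of_nonneg_right hm1'.le hα.le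
        have h2 : (‖siteToE (y - x)‖ + 1) * a β = ‖siteToE (y - x)‖ * a β + a β := by ring
        linarith only [h1, h2, hσ₂, haroom]
    exact pair_lower G r a hc hΓ hbox hC₁ hFBL hGA hCg' hGD hθ hFS hβ₀ hβ₁ hβ₆ hβ₆' hβ₇ hα hb₁ hb₆ hb₆' hb₇ hb₀
      hκL8 (kappa_mono hκUCg hκLU) (kappa_mono hκUCg' hκLU) η hν1 hn₆'ν hn₇ν hm1 hn₆m hνm hm2 h8m hdxm hdx'm hdxr hdyr
      h7x h7y h7x' hKf0 hs₁0 hσ₁ hΓm hκE hκE'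

end Assembly

end StubInherit

/-! ### The registered stub -/

/-- **stub_inherit** (registered stub of crux stmt-QuantumFields-16207, line `inherited-amplitude-gates`) — the
inheritance lemma, H1 load-bearing: for a continuous unit map, H1 ∧ `FitWindow` ∧ `FBL6` ∧ `GateAxis` ∧ `GateD` ∧
`FlatShape2` ⟹ `FC2I`.  The ABSOLUTE two-sided amplitude of the conditional two-point function of the action density,
for EVERY exterior, is inherited from the periodic femto torus: law of total covariance on a torus around the given
cube, FBL6 discharging the correction term and the gate budget, the η-relative gate SOLVED for the flat-box value and
propagated to every exterior, the flat shape comparison passing from the pinned axis pair to the density, and the lower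
side on a window of scales supplied by `FitWindow` through the growth windows of H1's shape function
(`StubInherit.fc2I_of_data`; hypothesis `IsCompactSimpleLieGroup G` unused). [folklore] -/
theorem stub_inherit : ∀ (G : Type) [Group G] [TopologicalSpace G] [IsTopologicalGroup G] [CompactSpace G] [MeasurableSpace G] [BorelSpace G], IsCompactSimpleLieGroup G → ∀ (r : LatticeRep G) (a : ℝ → ℝ), Continuous a → TwoPoint G r a → FitWindow G r a → FBL6 G r a → GateAxis G r a → GateD G r a → FlatShape2 G r a → FC2I G r a := by
  intro G _ _ _ _ _ _ _ r a ha h1 hfit hFBL6 hGA hGD hFS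
  obtain ⟨Γ, β₀, ℓ₀, c, C, hℓ₀, hc, hpos, hlim, hΓ, hbox⟩ := h1
  obtain ⟨C₁, β₁, ℓ₁, p, hℓ₁, hC₁, hF⟩ := hFBL6
  obtain ⟨Cg, β₆, ℓ₆, n₆, hCg, hℓ₆, hn₆, hGAc⟩ := hGA
  obtain ⟨Cg', β₆', ℓ₆', n₆', hCg', hℓ₆', -, hGDc⟩ := hGD
  obtain ⟨θ, β₇, ℓ₇, κ₇, n₇, hθ, hℓ₇, hFSc⟩ := hFS
  exact StubInherit.fc2I_of_data G r a ha hℓ₀ hc hpos hlim hΓ hbox hfit hℓ₁ hC₁ hF hCg hℓ₆ hn₆ hGAc hCg' hℓ₆' hGDc hθ hℓ₇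
    hFSc

end Summit.QuantumFields.YangMills.Cruxes.OSLegsAtWeakCouplingC.InheritedAmplitudeGates

end
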